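import Mathlib
import Literature.AlgebraicGeometry.Resolution.CobordantGame
import Literature.AlgebraicGeometry.Resolution.CobordantChartCoefficients
import Literature.AlgebraicGeometry.Resolution.AxisPolyhedron
import Literature.NumberTheory.Transcendental.RoySmallValueEstimatesHomogenizationProofs
import Summits.ResolutionOfSingularities.ResolutionOfSingularities.Theorems.WeightedInvariantLocalWeightedDropAxisWeightedMoveCone

/-!
# `WeightedInvariant.LocalWeightedDrop`, line `hasse-ridge-face-selection`: the weighted move (B2), part 2 —
# the pure-`y'` part of a successor and the order drop off the axis point

Crux item stmt-ResolutionOfSingularities-8899 (route `ResolutionOfSingularities/WeightedInvariant`), skeleton v18 of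
the line `hasse-ridge-face-selection`, helpers toward stub `stub_axisWeightedMove` (B2).

Let `g ∈ k[[x', z]]` be an axis germ of order `d` (`AxisCone`: the degree-`d` form `F` involves no `z`) above the level
`m ≥ 1` (`AboveLevel d m 1 g`), play the weighted move `(X, w)` with `w = (m, …, m, 1)`, and let `G` be the
`s`-saturated transform at an exceptional point `c = (c', c_z)`: `g(chart w c) = s^{md} · G`.
* `coeff_cons_zero_eq_sum` — the coefficient `s⁰ y'^β y_z⁰` of `G` is
  `Σ_{|b| ≤ d} g_{(b, m(d-|b|))} c_z^{m(d-|b|)} Π_j C(b_j, β_j) c'_j^{b_j - β_j}`, the `y'^β`-coefficient of the translate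
  `P(c' + y')` of `P(X') := F(X') + Λ_m(X', c_z)` (the `w`-initial form of `g` with `z := c_z`);
* `translateP_eq_form` — if these coefficients vanish in degrees `< d` (e.g. `ord G ≥ d`), then `P(c' + X') = F(X')` as
  polynomials (binomial vanishing in degrees `≥ d`);
* `false_of_axisPoint_zero` — `c_z = 0`, `c' ≠ 0`: then `F(v + c') = F(v)` for all `v`, against `TrivialApexX`;
* `false_of_offAxis` — `c_z ≠ 0`, `c' ≠ 0` (`k` infinite): then `F(v) + Λ_m(v, c_z) = F(v - c')` for all `v`, so
  `-c'/c_z^m ≠ 0` solves the level-`m` vertex (part 1, `solvable_of_eval`), against `PreparedAxis`;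
* `order_lt_of_ne_zero` — HENCE `ord G < d` at every exceptional point with `c' ≠ 0`.
Also generic bookkeeping for part 3: `Literature.NumberTheory.Transcendental.NguyenRoy.degree_cons_eq`, `finsum_eq_sum_cons` (re-indexing by tails), `mapDomain_castSucc_cons_eq`,
`initEval_one_smul` (homogeneity of the degree-`d` form), `initEval_add_smul_eq` (invariance vectors are stable under scalars).
-/

set_option linter.dupNamespace false -- mandated namespace of this single-conjunct summit

namespace Summit.ResolutionOfSingularities.ResolutionOfSingularities.Theorems

open Literature.AlgebraicGeometry.Resolution

namespace AxisWeightedMove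

variable {k : Type} [Field k] {n : ℕ}

/-! ### Finite sets of `x'`-exponents -/

/-- Membership in the set of exponents of degree `≤ d`. -/
theorem mem_belowSucc_iff (d : ℕ) (b : Fin n →₀ ℕ) :
    b ∈ (Finset.range (d + 1)).biUnion (fun r => (Finset.univ : Finset (Fin n)).finsuppAntidiag r) ↔
      b.degree ≤ d := by
  rw [mem_below_iff]
  omega

/-- Splitting the exponents of degree `≤ d` into degree `d` and degree `< d`. -/
theorem sum_belowSucc {M : Type*} [AddCommMonoid M] (d : ℕ) (f : (Fin n →₀ ℕ) → M) :
    ∑ b ∈ (Finset.range (d + 1)).biUnion (fun r => (Finset.univ : Finset (Fin n)).finsuppAntidiag r), f b =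
      ∑ b ∈ (Finset.univ : Finset (Fin n)).finsuppAntidiag d, f b +
        ∑ b ∈ (Finset.range d).biUnion (fun r => (Finset.univ : Finset (Fin n)).finsuppAntidiag r), f b := by
  classical
  rw [Finset.range_add_one, Finset.biUnion_insert, Finset.sum_union]
  rw [Finset.disjoint_left]
  intro b hb hb'
  rw [mem_antidiag_iff_degree] at hb
  rw [mem_below_iff] at hb'
  omega

/-! ### The pure-`y'` coefficients of the successor -/

section Successor

variable {w : Fin (n + 1) → ℕ} {m : ℕ} (hw1 : w (Fin.last n) = 1) (hwm : ∀ j, w (Fin.castSucc j) = m)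
  (hm : 1 ≤ m) {d : ℕ} {g : MvPowerSeries (Fin (n + 1)) k} {c : Fin (n + 1) → k}
  {G : MvPowerSeries (Fin (n + 2)) k}
  (hfac : MvPowerSeries.subst (CobordantChart.chart w c) g = MvPowerSeries.X 0 ^ (m * d) * G)

include hw1 hwm hm hfac in
/-- THE COEFFICIENT `s⁰ y'^β y_z⁰` OF THE SUCCESSOR: for `β_z = 0`,
`coeff (0, β) G = Σ_{|b| ≤ d} g_{(b, m(d-|b|))} c_z^{m(d-|b|)} Π_j C(b_j, β_j) c'_j^{b_j - β_j}`
(`CobordantChart.coeff_subst_chart`, re-indexed by `x'`-parts: the exponents of `w`-weight `m d` are the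
`(b, m(d - |b|))`, `|b| ≤ d`). -/
theorem coeff_cons_zero_eq_sum {β : Fin (n + 1) →₀ ℕ} (hβ : β (Fin.last n) = 0) :
    MvPowerSeries.coeff (Finsupp.cons 0 β) G =
      ∑ b ∈ (Finset.range (d + 1)).biUnion (fun r => (Finset.univ : Finset (Fin n)).finsuppAntidiag r),
        MvPowerSeries.coeff (Finsupp.equivFunOnFinite.symm
            (Fin.snoc (⇑b) (m * (d - b.degree)) : Fin (n + 1) → ℕ)) g * c (Fin.last n) ^ (m * (d - b.degree)) *
          ∏ j, (((b j).choose (β (Fin.castSucc j)) : k) * c (Fin.castSucc j) ^ (b j - β (Fin.castSucc j))) := by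
  have hconv : ∀ i, w i = 0 → c i = 0 := fun i hi => absurd hi (weight_pos hw1 hwm hm i).ne'
  rw [CobordantChart.coeff_cons_of_eq_X_pow_mul hfac, add_zero, CobordantChart.coeff_subst_chart w c hconv,
    finsum_eq_sum_snoc ((Finset.range (d + 1)).biUnion (fun r => (Finset.univ : Finset (Fin n)).finsuppAntidiag r))
      (fun b => m * (d - b.degree)) _ ?_]
  · refine Finset.sum_congr rfl fun b hb => ?_
    rw [mem_belowSucc_iff] at hb
    rw [if_pos (by rw [weight_eq hw1 hwm, xDeg_snoc, snoc_last, ← Nat.mul_add, Nat.add_sub_cancel' hb]),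
      Fin.prod_univ_castSucc]
    simp only [snoc_castSucc, snoc_last, hβ, Nat.choose_zero_right, Nat.cast_one, one_mul, Nat.sub_zero]
    ring
  · intro E hE
    have hwE : Finsupp.weight w E = m * d := by
      by_contra h
      exact hE (if_neg h)
    rw [weight_eq hw1 hwm] at hwE
    have hxle : AxisPolyhedron.xDeg E ≤ d := by
      have : m * AxisPolyhedron.xDeg E ≤ m * d := by omega
      exact Nat.le_of_mul_le_mul_left this (by omega)
    refine ⟨(mem_belowSucc_iff d _).mpr (by rwa [← xDeg_eq_degree_xPart]), ?_⟩
    rw [← xDeg_eq_degree_xPart, Nat.mul_sub, ← hwE, Nat.add_sub_cancel_left]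

include hw1 hwm hm hfac in
/-- The same coefficients as Taylor coefficients of the translate `P(c' + X')`,
`P(X') = Σ_{|b| ≤ d} g_{(b, m(d-|b|))} c_z^{m(d-|b|)} X'^b`. -/
theorem coeff_translateP (β : Fin n →₀ ℕ) :
    MvPolynomial.coeff β (∑ b ∈ (Finset.range (d + 1)).biUnion
        (fun r => (Finset.univ : Finset (Fin n)).finsuppAntidiag r),
        MvPolynomial.C (MvPowerSeries.coeff (Finsupp.equivFunOnFinite.symm
            (Fin.snoc (⇑b) (m * (d - b.degree)) : Fin (n + 1) → ℕ)) g * c (Fin.last n) ^ (m * (d - b.degree))) *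
          ∏ j, (MvPolynomial.C (c (Fin.castSucc j)) + MvPolynomial.X j) ^ (b j)) =
      MvPowerSeries.coeff (Finsupp.cons 0
        (Finsupp.equivFunOnFinite.symm (Fin.snoc (⇑β) 0 : Fin (n + 1) → ℕ))) G := by
  rw [coeff_cons_zero_eq_sum hw1 hwm hm hfac (snoc_last β 0), MvPolynomial.coeff_sum]
  refine Finset.sum_congr rfl fun b _ => ?_
  rw [MvPolynomial.coeff_C_mul, CobordantChart.coeff_prod_C_add_X_pow]
  simp only [snoc_castSucc]

include hw1 hwm hm hfac in
/-- `P(c' + X') = F(X')` AS POLYNOMIALS when the pure-`y'` coefficients of the successor vanish in degrees `< d`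
(low degrees: the hypothesis; degrees `≥ d`: for `|b| ≤ d ≤ |β|`, `b ≠ β`, some `b_j < β_j` kills `C(b_j, β_j)`). -/
theorem translateP_eq_form
    (hG : ∀ β : Fin n →₀ ℕ, β.degree < d →
      MvPowerSeries.coeff (Finsupp.cons 0 (Finsupp.equivFunOnFinite.symm (Fin.snoc (⇑β) 0 : Fin (n + 1) → ℕ))) G = 0) :
    (∑ b ∈ (Finset.range (d + 1)).biUnion (fun r => (Finset.univ : Finset (Fin n)).finsuppAntidiag r),
        MvPolynomial.C (MvPowerSeries.coeff (Finsupp.equivFunOnFinite.symm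
            (Fin.snoc (⇑b) (m * (d - b.degree)) : Fin (n + 1) → ℕ)) g * c (Fin.last n) ^ (m * (d - b.degree))) *
          ∏ j, (MvPolynomial.C (c (Fin.castSucc j)) + MvPolynomial.X j) ^ (b j)) =
      ∑ b ∈ (Finset.univ : Finset (Fin n)).finsuppAntidiag d,
        MvPolynomial.monomial b (MvPowerSeries.coeff
          (Finsupp.equivFunOnFinite.symm (Fin.snoc (⇑b) 0 : Fin (n + 1) → ℕ)) g) := by
  classical
  refine MvPolynomial.ext _ _ fun β => ?_
  have hF : MvPolynomial.coeff β (∑ b ∈ (Finset.univ : Finset (Fin n)).finsuppAntidiag d,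
      MvPolynomial.monomial b (MvPowerSeries.coeff
        (Finsupp.equivFunOnFinite.symm (Fin.snoc (⇑b) 0 : Fin (n + 1) → ℕ)) g)) =
      if β.degree = d then MvPowerSeries.coeff
        (Finsupp.equivFunOnFinite.symm (Fin.snoc (⇑β) 0 : Fin (n + 1) → ℕ)) g else 0 := by
    rw [MvPolynomial.coeff_sum]
    simp_rw [MvPolynomial.coeff_monomial]
    rw [Finset.sum_ite_eq']
    by_cases hβ : β.degree = d
    · rw [if_pos ((mem_antidiag_iff_degree d β).mpr hβ), if_pos hβ]
    · rw [if_neg (fun h => hβ ((mem_antidiag_iff_degree d β).mp h)), if_neg hβ]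
  rw [hF]
  by_cases hβd : β.degree < d
  · rw [coeff_translateP hw1 hwm hm hfac, hG β hβd, if_neg (by omega)]
  · push Not at hβd
    rw [MvPolynomial.coeff_sum]
    have hkill : ∀ b ∈ (Finset.range (d + 1)).biUnion
        (fun r => (Finset.univ : Finset (Fin n)).finsuppAntidiag r), b ≠ β →
        MvPolynomial.coeff β (MvPolynomial.C (MvPowerSeries.coeff (Finsupp.equivFunOnFinite.symm
            (Fin.snoc (⇑b) (m * (d - b.degree)) : Fin (n + 1) → ℕ)) g * c (Fin.last n) ^ (m * (d - b.degree))) *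
          ∏ j, (MvPolynomial.C (c (Fin.castSucc j)) + MvPolynomial.X j) ^ (b j)) = 0 := by
      intro b hb hne
      rw [mem_belowSucc_iff] at hb
      rw [MvPolynomial.coeff_C_mul, CobordantChart.coeff_prod_C_add_X_pow,
        ApexFreeOrderDrop.prod_choose_mul_pow_eq_zero _ (ApexFreeOrderDrop.exists_apply_lt (by omega) hne),
        mul_zero]
    by_cases hβ : β.degree = d
    · rw [Finset.sum_eq_single β hkill (fun hnot => absurd ((mem_belowSucc_iff d β).mpr hβ.le) hnot),
        MvPolynomial.coeff_C_mul, CobordantChart.coeff_prod_C_add_X_pow, if_pos hβ, hβ, Nat.sub_self,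
        mul_zero, pow_zero, mul_one]
      simp
    · rw [if_neg hβ]
      refine Finset.sum_eq_zero fun b hb => hkill b hb ?_
      rintro rfl
      rw [mem_belowSucc_iff] at hb
      omega

include hw1 hwm hm hfac in
/-- … EVALUATED: `Σ_{|b| ≤ d} g_{(b, m(d-|b|))} c_z^{m(d-|b|)} (c' + v)^b = F(v)` for every `v ∈ kⁿ`. -/
theorem eval_translateP_eq
    (hG : ∀ β : Fin n →₀ ℕ, β.degree < d →
      MvPowerSeries.coeff (Finsupp.cons 0 (Finsupp.equivFunOnFinite.symm (Fin.snoc (⇑β) 0 : Fin (n + 1) → ℕ))) G = 0)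
    (v : Fin n → k) :
    ∑ b ∈ (Finset.range (d + 1)).biUnion (fun r => (Finset.univ : Finset (Fin n)).finsuppAntidiag r),
        MvPowerSeries.coeff (Finsupp.equivFunOnFinite.symm
            (Fin.snoc (⇑b) (m * (d - b.degree)) : Fin (n + 1) → ℕ)) g * c (Fin.last n) ^ (m * (d - b.degree)) *
          ∏ j, (c (Fin.castSucc j) + v j) ^ (b j) =
      ∑ b ∈ (Finset.univ : Finset (Fin n)).finsuppAntidiag d,
        MvPowerSeries.coeff (Finsupp.equivFunOnFinite.symm (Fin.snoc (⇑b) 0 : Fin (n + 1) → ℕ)) g *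
          ∏ j, v j ^ b j := by
  have h := congrArg (MvPolynomial.eval v) (translateP_eq_form hw1 hwm hm hfac hG)
  rw [map_sum, map_sum] at h
  convert h using 1
  · refine Finset.sum_congr rfl fun b _ => ?_
    rw [map_mul, MvPolynomial.eval_C, map_prod]
    congr 1
    refine Finset.prod_congr rfl fun j _ => ?_
    rw [map_pow, map_add, MvPolynomial.eval_C, MvPolynomial.eval_X]
  · refine Finset.sum_congr rfl fun b _ => ?_
    rw [MvPolynomial.eval_monomial, Finsupp.prod_pow]

include hw1 hwm hm hfac in
/-- THE AXIS POINT OF THE EXCEPTIONAL DIVISOR IS NOT REACHED WITH `c' ≠ 0`, CASE `c_z = 0`: if the pure-`y'`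
coefficients of `G` vanish in degrees `< d`, then `F(v + c') = F(v)` for all `v` (the terms `|b| < d` carry
`c_z^{m(d-|b|)} = 0`), so `(c', 0)` is a translation-invariance vector inside `z = 0` — impossible under
`TrivialApexX` when `c' ≠ 0`. -/
theorem false_of_axisCoord_zero (hcone : AxisPolyhedron.AxisCone d g) (hapex : AxisPolyhedron.TrivialApexX d g)
    (hcz : c (Fin.last n) = 0) (hc' : (fun j : Fin n => c (Fin.castSucc j)) ≠ 0)
    (hG : ∀ β : Fin n →₀ ℕ, β.degree < d →
      MvPowerSeries.coeff (Finsupp.cons 0 (Finsupp.equivFunOnFinite.symm (Fin.snoc (⇑β) 0 : Fin (n + 1) → ℕ))) G = 0) :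
    False := by
  obtain ⟨v, hv⟩ := hapex _ hc'
  apply hv
  rw [snoc_add_snoc, initEval_snoc_zero hcone, initEval_snoc_zero hcone, ← eval_translateP_eq hw1 hwm hm hfac hG v,
    sum_belowSucc, ← add_zero (Finset.sum _ _)]
  congr 1
  · refine Finset.sum_congr rfl fun b hb => ?_
    rw [mem_antidiag_iff_degree] at hb
    rw [hb, Nat.sub_self, mul_zero, pow_zero, mul_one]
    congr 1
    exact Finset.prod_congr rfl fun j _ => by rw [Pi.add_apply, add_comm]
  · symm
    refine Finset.sum_eq_zero fun b hb => ?_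
    rw [mem_below_iff] at hb
    rw [hcz, zero_pow (Nat.mul_ne_zero (by omega) (by omega)), mul_zero, zero_mul]

include hw1 hwm hm hfac in
/-- THE EXCEPTIONAL POINTS OFF THE AXIS POINT, CASE `c_z ≠ 0`, `c' ≠ 0` (`k` infinite): if the pure-`y'` coefficients
of `G` vanish in degrees `< d`, then `F(v) + Λ_m(v, c_z) = F(v - c')` for all `v`, so `λ = -c'/c_z^m ≠ 0` solves the
level-`m` vertex (`solvable_of_eval`) — impossible for a prepared axis germ above the level `m`. -/
theorem false_of_axisCoord_ne_zero [Infinite k] (hlev : AxisPolyhedron.AboveLevel d m 1 g)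
    (hprep : AxisPolyhedron.PreparedAxis d g) (hcz : c (Fin.last n) ≠ 0)
    (hc' : (fun j : Fin n => c (Fin.castSucc j)) ≠ 0)
    (hG : ∀ β : Fin n →₀ ℕ, β.degree < d →
      MvPowerSeries.coeff (Finsupp.cons 0 (Finsupp.equivFunOnFinite.symm (Fin.snoc (⇑β) 0 : Fin (n + 1) → ℕ))) G = 0) :
    False := by
  have hsol := solvable_of_eval (d := d) (M := m) (g := g) (t := c (Fin.last n)) hcz
    (γ := fun j : Fin n => c (Fin.castSucc j)) hlev fun v => by
    have h := eval_translateP_eq hw1 hwm hm hfac hG (v - fun j => c (Fin.castSucc j))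
    rw [sum_belowSucc] at h
    simp only [Pi.sub_apply, add_sub_cancel] at h
    rw [← h]
    congr 1
    refine Finset.sum_congr rfl fun b hb => ?_
    rw [mem_antidiag_iff_degree] at hb
    rw [hb, Nat.sub_self, mul_zero, pow_zero, mul_one]
  refine hprep m _ ?_ hsol
  intro h0
  apply hc'
  have hu : (c (Fin.last n) ^ m)⁻¹ ≠ 0 := inv_ne_zero (pow_ne_zero _ hcz)
  have := (smul_eq_zero.mp h0).resolve_left hu
  exact neg_eq_zero.mp this

include hw1 hwm hm hfac in
/-- HENCE THE ORDER DROPS: at an exceptional point with `c' ≠ 0` of the weighted move from a prepared axis germ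
(order `d`, `AxisCone`, `TrivialApexX`, above the level `m`, `PreparedAxis`), the successor `G` has order `< d`. -/
theorem order_lt_of_ne_zero [Infinite k] (hcone : AxisPolyhedron.AxisCone d g)
    (hapex : AxisPolyhedron.TrivialApexX d g) (hlev : AxisPolyhedron.AboveLevel d m 1 g)
    (hprep : AxisPolyhedron.PreparedAxis d g) (hc' : ∃ j : Fin n, c (Fin.castSucc j) ≠ 0) :
    G.order < (d : ℕ∞) := by
  by_contra hge
  push Not at hge
  have hG : ∀ β : Fin n →₀ ℕ, β.degree < d →
      MvPowerSeries.coeff (Finsupp.cons 0 (Finsupp.equivFunOnFinite.symm (Fin.snoc (⇑β) 0 : Fin (n + 1) → ℕ))) G = 0 :=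
    fun β hβd => MvPowerSeries.coeff_of_lt_order (lt_of_lt_of_le
      (by rw [AxisMove.degree_cons_zero, degree_snoc, add_zero]; exact_mod_cast hβd) hge)
  have hc'' : (fun j : Fin n => c (Fin.castSucc j)) ≠ 0 := by
    obtain ⟨j, hj⟩ := hc'
    exact fun h => hj (congrFun h j)
  by_cases hcz : c (Fin.last n) = 0
  · exact false_of_axisCoord_zero hw1 hwm hm hfac hcone hapex hcz hc'' hG
  · exact false_of_axisCoord_ne_zero hw1 hwm hm hfac hlev hprep hcz hc'' hG

end Successor

/-! ### Exponents `(r, b)` of the slice: `s`-exponent `r`, `y'`-part `b` -/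

/-- RE-INDEXING BY `y'`-PARTS: a finitely supported sum over exponents `e` whose support lies over a finite set `S`
of `y'`-parts (tails), with the `s`-exponent a function `ψ` of the tail, is the finite sum over `b ∈ S` of the terms
at `(ψ b, b)`. -/
theorem finsum_eq_sum_cons {M : Type*} [AddCommMonoid M] (S : Finset (Fin n →₀ ℕ))
    (ψ : (Fin n →₀ ℕ) → ℕ) (T : (Fin (n + 1) →₀ ℕ) → M)
    (hT : ∀ e, T e ≠ 0 → Finsupp.tail e ∈ S ∧ e 0 = ψ (Finsupp.tail e)) :
    ∑ᶠ e, T e = ∑ b ∈ S, T (Finsupp.cons (ψ b) b) := by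
  classical
  rw [finsum_eq_sum_of_support_subset T (s := S.image fun b : Fin n →₀ ℕ => Finsupp.cons (ψ b) b) ?_]
  · rw [Finset.sum_image]
    intro b₁ _ b₂ _ h
    have h' := congrArg Finsupp.tail h
    simpa only [Finsupp.tail_cons] using h'
  · intro e he
    obtain ⟨hS, h0⟩ := hT e he
    rw [Finset.coe_image]
    refine ⟨_, Finset.mem_coe.mpr hS, ?_⟩
    show Finsupp.cons (ψ (Finsupp.tail e)) (Finsupp.tail e) = e
    rw [← h0, Finsupp.cons_tail]

/-- Transporting the slice exponent `(r, b)` along `Fin.castSucc` gives `(r, b, 0)`. -/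
theorem mapDomain_castSucc_cons_eq (r : ℕ) (b : Fin n →₀ ℕ) :
    Finsupp.mapDomain (Fin.castSucc : Fin (n + 1) → Fin (n + 2)) (Finsupp.cons r b) =
      Finsupp.cons r (Finsupp.equivFunOnFinite.symm (Fin.snoc (⇑b) 0 : Fin (n + 1) → ℕ)) := by
  ext j
  refine Fin.cases ?_ (fun i => ?_) j
  · rw [Finsupp.cons_zero, show (0 : Fin (n + 2)) = Fin.castSucc (0 : Fin (n + 1)) from rfl,
      Finsupp.mapDomain_apply (Fin.castSucc_injective _), Finsupp.cons_zero]
  · rw [Finsupp.cons_succ]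
    refine Fin.lastCases ?_ (fun j' => ?_) i
    · rw [snoc_last, Finsupp.mapDomain_notin_range]
      rintro ⟨x, hx⟩
      exact (Fin.castSucc_lt_last x).ne hx
    · rw [snoc_castSucc, show (Fin.castSucc j').succ = Fin.castSucc j'.succ from rfl,
        Finsupp.mapDomain_apply (Fin.castSucc_injective _), Finsupp.cons_succ]

/-- HOMOGENEITY of the degree-`d` form: `in_d f (μ v) = μ^d in_d f (v)`. -/
theorem initEval_one_smul {N : ℕ} (μ : k) (v : Fin N → k) (d : ℕ) (f : MvPowerSeries (Fin N) k) :
    CobordantChart.initEval (fun _ : Fin N => 1) (μ • v) d f =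
      μ ^ d * CobordantChart.initEval (fun _ : Fin N => 1) v d f := by
  rw [ApexFreeOrderDrop.initEval_one_eq_sum, ApexFreeOrderDrop.initEval_one_eq_sum, Finset.mul_sum]
  refine Finset.sum_congr rfl fun e he => ?_
  have hdeg : ∑ i, e i = d := by
    rw [← Finsupp.degree_eq_sum, ← ApexFreeOrderDrop.weight_one_eq_degree]
    exact (ApexFreeOrderDrop.mem_antidiag_iff d e).mp he
  simp only [Pi.smul_apply, smul_eq_mul, mul_pow]
  rw [Finset.prod_mul_distrib, Finset.prod_pow_eq_pow_sum, hdeg]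
  ring

/-- The translation-invariance vectors of a form are stable under scalars: if `in_d f (v + u) = in_d f (v)` for all
`v`, then `in_d f (v + μ u) = in_d f (v)` for all `v` and `μ`. -/
theorem initEval_add_smul_eq {N : ℕ} {d : ℕ} {f : MvPowerSeries (Fin N) k} {u : Fin N → k}
    (hu : ∀ v : Fin N → k, CobordantChart.initEval (fun _ : Fin N => 1) (v + u) d f =
      CobordantChart.initEval (fun _ : Fin N => 1) v d f) (μ : k) (v : Fin N → k) :
    CobordantChart.initEval (fun _ : Fin N => 1) (v + μ • u) d f =
      CobordantChart.initEval (fun _ : Fin N => 1) v d f := by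
  by_cases hμ : μ = 0
  · rw [hμ, zero_smul, add_zero]
  · have h1 : v + μ • u = μ • (μ⁻¹ • v + u) := by
      rw [smul_add, smul_smul, mul_inv_cancel₀ hμ, one_smul]
    have h2 : v = μ • (μ⁻¹ • v) := by rw [smul_smul, mul_inv_cancel₀ hμ, one_smul]
    rw [h1, initEval_one_smul, hu, ← initEval_one_smul, ← h2]


end AxisWeightedMove

end Summit.ResolutionOfSingularities.ResolutionOfSingularities.Theorems
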